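import Summits.QuantumFields.BalabanUV.Gaps.EndDrawdownModulusStrict
import Summits.QuantumFields.BalabanUV.Gaps.EndDrawdownCooperatorExtremal

/-!
# Gaps / EndDrawdownModulusExtremal — EVERY MODULUS ROAD IS DECIDED BY ITS COOPERATOR: for a remainder modulus `ω` (`EndDrawdownModulusRoad.IsModulus`:
# continuous, monotone, positive on `]0,∞[`, `ω(0⁺) = 0`) possibility of the END statement over the class `|β¹_{k+1}| ≤ ω(g_k)`
# (`EndDrawdownModulusStrict.EndPossibleMod`) is the END of ONE Markov family, the MODULUS COOPERATOR `β_{k+1} = b_k + ω(g_k)` — in the tree's terms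
# `EndDrawdownModulusRoad.betaMod b (−ω)` —, for the canonical construction: **`endPossibleMod_iff_modelOf`**; box-free (`endPossibleMod_box_free`),
# and equal to possibility over the ONE-SIDED class `β¹_{k+1} ≤ ω(g_k)` with no lower bound and no (C) (`endPossibleMod_of_upperRealization`).
# Instance of `EndDrawdownCooperatorExtremal.endpointExistence_coop_of_dominated` with help `H = ω` (monotone cooperators are extremal); the linear
# road (`endPossibleLin_iff_modelOf`) is the case `ω = C·x`.  So for EVERY hypothesis shape «|β¹_{k+1}| ≤ ω(g_k)» on row (D4)'s remainder, FORCING is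
# the every-slope threshold (`EndDrawdownModulusRoad.endForcedMod_iff_dwSeq_pos`) and POSSIBILITY is one deterministic backward-orbit condition on
# `b_k + ω(g_k)` (cell pub-balaban-gaps, seat g1-p3 GEN 10, rows CAP ∕ tail ∕ (D4) «split ∕ weakening»; this seat's own leaf; file 21 of «the
# one-loop interface of the END statement»)

HONEST FRAMING (cell rule, page 1 of everything): [folklore] bookkeeping over `EndDrawdownCooperatorExtremal`; `EndPossibleMod` is a quantified
READING of the cell's END-grade statement over Bałaban-free data `(b, ω, γ₀)`, not a binder; every modulus road is a located UNPRINTED hypothesis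
shape on row (D4)'s remainder; NOTHING of Bałaban's table is certified (NODE-O 0∕1, CAP coefficients 0); words ∕ odds of rows CAP ∕ tail ∕ (D4) ∕
(D1) UNCHANGED; 0∕6 binders; one finite T⁴; NOT [I] Thm 2, NOT `BetaPertH`, NOT the continuum limit, NOT Clay.

CITATION HEADER (tags CONTEXT ONLY).  [I] = T. Bałaban, Commun. Math. Phys. **109** (1987) 249–301 [Balaban1987RG1]: (0.20) p. 256, Thm 2
p. 259 (first sentence), (2.12)–(2.14) p. 268.
-/

namespace Summit.QuantumFields.BalabanUV.Gaps.EndDrawdownModulusExtremal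

open Literature.MathematicalPhysics.QuantumFieldTheory.Balaban1983to89
open Literature.MathematicalPhysics.QuantumFieldTheory.Balaban1983to89.FlowStep
open Literature.MathematicalPhysics.QuantumFieldTheory.Balaban1983to89.FlowStepRuns
open Literature.MathematicalPhysics.QuantumFieldTheory.Balaban1983to89.DagBinding
open Summit.QuantumFields.BalabanUV.Gaps.EndDrawdownModulusRoad
open Summit.QuantumFields.BalabanUV.Gaps.EndDrawdownModulusStrict
open Summit.QuantumFields.BalabanUV.Gaps.EndDrawdownCooperatorExtremal

noncomputable section

variable {b : ℕ → ℝ} {ω : ℝ → ℝ} {γ₀ : ℝ}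

/-- THE MODULUS COOPERATOR is `betaMod b (−ω)`: on a history with positive last coupling `β_{k+1} = b_k + ω(g_k)`. [folklore] -/
theorem betaModCoop_of_pos (b : ℕ → ℝ) (ω : ℝ → ℝ) (k : ℕ) {p : Fin (k + 1) → ℝ} (hp : 0 < p (Fin.last k)) :
    betaMod b (fun x => -ω x) k p = b k + ω (p (Fin.last k)) := by
  rw [betaMod_of_pos b _ k hp]; ring

/-- (C) for the modulus cooperator on every box (ω continuous on `]0,∞[`). [folklore] -/
theorem betaContH_betaModCoop (b : ℕ → ℝ) (hω : IsModulus ω) (γ : ℝ) : BetaContH γ (betaMod b (fun x => -ω x)) := fun k =>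
  (continuousOn_const.add (hω.cont.comp (continuous_apply (Fin.last k)).continuousOn
    fun _ hp => ((mem_box.mp hp) (Fin.last k)).1)).congr fun _ hp => betaModCoop_of_pos b ω k ((mem_box.mp hp) (Fin.last k)).1

/-- The modulus cooperator lies in the modulus class on every box: `|β¹_{k+1}(p)| = ω(p_k) ≤ ω(p_k)`. [folklore] -/
theorem mod_splitModCoop (b : ℕ → ℝ) (hω : IsModulus ω) (γ : ℝ) (k : ℕ) (p : Fin (k + 1) → ℝ) (hp : p ∈ B12Beta.HistBox γ k) :
    |(splitMod b (fun x => -ω x)).β1 k p| ≤ ω (p (Fin.last k)) := by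
  have hlast := (hp (Fin.last k)).1
  show |(if 0 < p (Fin.last k) then -(-ω (p (Fin.last k))) else 0)| ≤ ω (p (Fin.last k))
  rw [if_pos hlast, neg_neg, abs_of_pos (hω.pos _ hlast)]

/-- A modulus is continuous and non-decreasing on every box `]0,γ]`. [folklore] -/
theorem modulus_on_box (hω : IsModulus ω) (γ : ℝ) : ContinuousOn ω (Set.Ioc 0 γ) ∧ MonotoneOn ω (Set.Ioc 0 γ) :=
  ⟨hω.cont.mono fun _ hx => hx.1, fun _ hx _ _ hxy => hω.mono _ _ hx.1 hxy⟩

/-- **POSSIBLE OVER A MODULUS CLASS ⟹ EVERY FORWARD-GENERATED CONSTRUCTION OF THE MODULUS COOPERATOR HAS E** (`0 < γ₀`): the witnessing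
realization has `β¹ ≤ |β¹| ≤ ω(g_k)` and the cooperator inherits its runs (`endpointExistence_coop_of_dominated` with help `ω`).
[cite: Balaban1987RG1, Thm 2 p.259 (first sentence) and (2.12)–(2.14) p.268] -/
theorem endpointExistence_modCoop_of_endPossibleMod (hω : IsModulus ω) (hγ₀ : 0 < γ₀) (h : EndPossibleMod b ω γ₀)
    {Cn : B12.Construction} (hgen : ForwardGenerated Cn (betaMod b (fun x => -ω x))) : EndpointExistence Cn := by
  obtain ⟨β', S', C', hb, hM, -, hgen', hE'⟩ := h
  exact endpointExistence_coop_of_dominated (H := ω) hγ₀ (modulus_on_box hω γ₀).1 (modulus_on_box hω γ₀).2 S' hb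
    (fun k p hp => (le_abs_self _).trans (hM k p hp)) hgen' hE' (fun k _ hp => betaModCoop_of_pos b ω k hp) hgen

/-- **EVERY MODULUS ROAD IS DECIDED BY ITS COOPERATOR** · `EndPossibleMod b ω γ₀ ⟺ EndpointExistence (modelOf (betaMod b (−ω)))` (`0 < γ₀`):
possibility over the whole class `|β¹_{k+1}| ≤ ω(g_k)` is ONE deterministic backward-orbit condition on `b_k + ω(g_k)`.
[cite: Balaban1987RG1, Thm 2 p.259 (first sentence) and (2.12)–(2.14) p.268] -/
theorem endPossibleMod_iff_modelOf (hω : IsModulus ω) (hγ₀ : 0 < γ₀) :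
    EndPossibleMod b ω γ₀ ↔ EndpointExistence (modelOf (betaMod b (fun x => -ω x))) :=
  ⟨fun h => endpointExistence_modCoop_of_endPossibleMod hω hγ₀ h (modelOf_forwardGenerated _), fun hE =>
    ⟨betaMod b (fun x => -ω x), splitMod b (fun x => -ω x), modelOf _, fun _ => rfl, mod_splitModCoop b hω γ₀,
      betaContH_betaModCoop b hω γ₀, modelOf_forwardGenerated _, hE⟩⟩

/-- … equivalently: possible over the class iff the modulus cooperator is FORCED within its own forward-generated constructions.
[cite: Balaban1987RG1, Thm 2 p.259 (first sentence) and (2.12)–(2.14) p.268] -/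
theorem endPossibleMod_iff_allFwd (hω : IsModulus ω) (hγ₀ : 0 < γ₀) :
    EndPossibleMod b ω γ₀ ↔ ∀ Cn : B12.Construction, ForwardGenerated Cn (betaMod b (fun x => -ω x)) → EndpointExistence Cn :=
  ⟨fun h _ hgen => endpointExistence_modCoop_of_endPossibleMod hω hγ₀ h hgen,
    fun h => (endPossibleMod_iff_modelOf hω hγ₀).mpr (h _ (modelOf_forwardGenerated _))⟩

/-- **BOX-FREE** · possibility over a modulus class does not depend on the box. [folklore] -/
theorem endPossibleMod_box_free (hω : IsModulus ω) {γ₀ γ₀' : ℝ} (hγ₀ : 0 < γ₀) (hγ₀' : 0 < γ₀') :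
    EndPossibleMod b ω γ₀ ↔ EndPossibleMod b ω γ₀' := by
  rw [endPossibleMod_iff_modelOf hω hγ₀, endPossibleMod_iff_modelOf hω hγ₀']

/-- **THE ONE-SIDED CLASS IS THE TWO-SIDED CLASS** · a history family with one-loop part `b` and remainder merely bounded ABOVE by the modulus,
`β¹_{k+1}(g_0,…,g_k) ≤ ω(g_k)` on the `]0,γ₀]`-histories (no lower bound, no continuity), one forward-generated construction of which has E,
already gives `EndPossibleMod b ω γ₀`. [cite: Balaban1987RG1, Thm 2 p.259 (first sentence) and (2.12)–(2.14) p.268] -/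
theorem endPossibleMod_of_upperRealization (hω : IsModulus ω) (hγ₀ : 0 < γ₀) {β' : HBeta} (S' : B12Beta.OneLoopSplit β')
    (hb : ∀ j, S'.β0 j = b j) (hup : ∀ (k : ℕ) (p : Fin (k + 1) → ℝ), p ∈ B12Beta.HistBox γ₀ k → S'.β1 k p ≤ ω (p (Fin.last k)))
    {C' : B12.Construction} (hgen' : ForwardGenerated C' β') (hE' : EndpointExistence C') : EndPossibleMod b ω γ₀ :=
  (endPossibleMod_iff_modelOf hω hγ₀).mpr
    (endpointExistence_coop_of_dominated (H := ω) hγ₀ (modulus_on_box hω γ₀).1 (modulus_on_box hω γ₀).2 S' hb hup hgen' hE'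
      (fun k _ hp => betaModCoop_of_pos b ω k hp) (modelOf_forwardGenerated _))

/-- Monotone in the modulus: a pointwise larger modulus on `]0,γ₀]` keeps possibility. [folklore] -/
theorem endPossibleMod_mono {ω' : ℝ → ℝ} (hle : ∀ x, 0 < x → x ≤ γ₀ → ω x ≤ ω' x) (h : EndPossibleMod b ω γ₀) : EndPossibleMod b ω' γ₀ := by
  obtain ⟨β', S', Cn, hb, hM, hcont, hgen, hE⟩ := h
  exact ⟨β', S', Cn, hb, fun k p hp => (hM k p hp).trans (hle _ (hp (Fin.last k)).1 (hp (Fin.last k)).2), hcont, hgen, hE⟩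

/-- ON EVERY MODULUS ROAD THE ω-ADAPTED STAIRCASE'S COOPERATOR FAILS E for every `C > 0` (restating `EndDrawdownModulusStrict.not_endPossibleMod_bMod`
through the cooperator): even maximal help `C·ω(g_k)` cannot hold gen 9's `bMod hω` in any box. [cite: Balaban1987RG1, Thm 2 p.259 (first sentence)] -/
theorem not_endpointExistence_modCoop_bMod (hω : IsModulus ω) {C : ℝ} (hC : 0 < C) :
    ¬ EndpointExistence (modelOf (betaMod (bMod hω) (fun x => -(C * ω x)))) := fun hE =>
  not_endPossibleMod_bMod hω hC one_pos ((endPossibleMod_iff_modelOf (isModulus_smul hω hC) one_pos).mpr hE)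

end

end Summit.QuantumFields.BalabanUV.Gaps.EndDrawdownModulusExtremal
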